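import Summits.CriticalPhenomena.SAWScalingLimit.Theorems.SAWTotalPositivityBoundaryTP2Defs
import Summits.CriticalPhenomena.SAWScalingLimit.Theorems.SAWTotalPositivityBoundaryTP2Kernel
import Summits.CriticalPhenomena.SAWScalingLimit.Theorems.SAWTotalPositivityBoundaryTP2Symmetry
import Summits.CriticalPhenomena.SAWScalingLimit.Theorems.SAWTotalPositivityBoundaryTP2RectReflect
import Summits.CriticalPhenomena.SAWScalingLimit.Theorems.SAWTotalPositivityBoundaryTP2Strip3Facing
import Summits.CriticalPhenomena.SAWScalingLimit.Theorems.EdgeOfPositivity.Negative.EdgeOfPositivityRectDomain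
import HarnessLib

/-!
# Crux `BoundaryTP2` (stmt-CriticalPhenomena-7115), line `Sketch`: symmetries of the disjoint-pair kernels
(lead c6, bridge of the width-4 transfer, part 1)

The transfer recursions of the strip programme carry DISJOINT-PAIR kernels
`PS_H(a→b; c→d) = Σ_{γ : a → b, γ' : c → d, γ ∩ γ' = ∅} x^{|γ|+|γ'|}` (inline `tsum`s over Mathlib
`SimpleGraph.Path`).  This file records their two symmetries used by the odd/even sector bridge of the
width-4 transfer: reversal of the loop (`pairSum_reverse_right`) and invariance under graph isomorphisms
(`pairSum_le_map`, `pairSum_map_iso`), whence on the box `{0..a} × {0..b}` the invariance under the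
reflections `j ↦ b - j` (`rect_pairSum_reflect_snd`) and `i ↦ a - i`; plus finiteness on the 4-row strips.
Mathlib only (transport of `tsum`s along injections, `ENNReal.tsum_comp_le_tsum_of_injective`).
-/

noncomputable section

namespace Summit.CriticalPhenomena.SAWScalingLimit.Theorems.BoundaryTP2

open Literature.Probability.LatticeModels Literature.Probability.RandomPlanarGeometry
open Summit.CriticalPhenomena.SAWScalingLimit.Theorems.EdgeOfPositivity.Negative
open scoped ENNReal

section Generic

variable {V V' : Type*} {H : SimpleGraph V} {H' : SimpleGraph V'}

open Classical in
/-- Reversing the second path of a disjoint-pair sum does not change it (length and support as a set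
are invariant under reversal). [folklore] -/
theorem pairSum_reverse_right (H : SimpleGraph V) (x : ℝ) (a b c d : V) :
    (∑' (γ : H.Path a b) (γ' : H.Path d c),
        (if List.Disjoint γ.1.support γ'.1.support then
          ENNReal.ofReal (x ^ γ.1.length) * ENNReal.ofReal (x ^ γ'.1.length) else 0)) =
      ∑' (γ : H.Path a b) (γ' : H.Path c d),
        (if List.Disjoint γ.1.support γ'.1.support then
          ENNReal.ofReal (x ^ γ.1.length) * ENNReal.ofReal (x ^ γ'.1.length) else 0) := by
  refine tsum_congr fun γ => ?_
  refine (Equiv.tsum_eq (pathReverseEquiv H c d) _).symm.trans ?_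
  refine tsum_congr fun γ' => ?_
  simp only [pathReverseEquiv, Equiv.coe_fn_mk, SimpleGraph.Walk.support_reverse,
    List.disjoint_reverse_right, SimpleGraph.Walk.length_reverse]

/-- Mapping along an injective function preserves disjointness of lists. [folklore] -/
private theorem s4ps_disjoint_map_iff {f : V → V'} (hf : Function.Injective f) (l l' : List V) :
    List.Disjoint (l.map f) (l'.map f) ↔ List.Disjoint l l' := by
  constructor
  · intro h v hv hv'
    exact h (List.mem_map_of_mem hv) (List.mem_map_of_mem hv')
  · intro h w hw hw'
    obtain ⟨v, hv, rfl⟩ := List.mem_map.1 hw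
    obtain ⟨v', hv', hvv'⟩ := List.mem_map.1 hw'
    exact h hv (hf hvv' ▸ hv')

open Classical in
/-- A disjoint-pair sum can only increase along an injective graph homomorphism (pairs of
self-avoiding paths are carried injectively to pairs of the same lengths and the same disjointness).
[folklore] -/
theorem pairSum_le_map (f : H →g H') (hf : Function.Injective f) (x : ℝ) (a b c d : V) :
    (∑' (γ : H.Path a b) (γ' : H.Path c d),
        (if List.Disjoint γ.1.support γ'.1.support then
          ENNReal.ofReal (x ^ γ.1.length) * ENNReal.ofReal (x ^ γ'.1.length) else 0)) ≤
      ∑' (γ : H'.Path (f a) (f b)) (γ' : H'.Path (f c) (f d)),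
        (if List.Disjoint γ.1.support γ'.1.support then
          ENNReal.ofReal (x ^ γ.1.length) * ENNReal.ofReal (x ^ γ'.1.length) else 0) := by
  set F : H.Path a b × H.Path c d → ℝ≥0∞ := fun pq =>
    if List.Disjoint pq.1.1.support pq.2.1.support then
      ENNReal.ofReal (x ^ pq.1.1.length) * ENNReal.ofReal (x ^ pq.2.1.length) else 0 with hF
  set F' : H'.Path (f a) (f b) × H'.Path (f c) (f d) → ℝ≥0∞ := fun pq =>
    if List.Disjoint pq.1.1.support pq.2.1.support then
      ENNReal.ofReal (x ^ pq.1.1.length) * ENNReal.ofReal (x ^ pq.2.1.length) else 0 with hF'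
  set g : H.Path a b × H.Path c d → H'.Path (f a) (f b) × H'.Path (f c) (f d) := fun pq =>
    (SimpleGraph.Path.map f hf pq.1, SimpleGraph.Path.map f hf pq.2) with hg
  have hginj : Function.Injective g := by
    intro pq pq' h
    simp only [hg, Prod.mk.injEq] at h
    exact Prod.ext (SimpleGraph.Path.map_injective hf a b h.1) (SimpleGraph.Path.map_injective hf c d h.2)
  have hFg : ∀ pq, F' (g pq) = F pq := by
    intro pq
    simp only [hF, hF', hg, SimpleGraph.Path.map, SimpleGraph.Walk.support_map,
      SimpleGraph.Walk.length_map, s4ps_disjoint_map_iff hf]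
  calc (∑' (γ : H.Path a b) (γ' : H.Path c d),
          (if List.Disjoint γ.1.support γ'.1.support then
            ENNReal.ofReal (x ^ γ.1.length) * ENNReal.ofReal (x ^ γ'.1.length) else 0))
      = ∑' pq : H.Path a b × H.Path c d, F pq := (ENNReal.tsum_prod (f := fun γ γ' => F (γ, γ'))).symm
    _ = ∑' pq : H.Path a b × H.Path c d, F' (g pq) := tsum_congr fun pq => (hFg pq).symm
    _ ≤ ∑' pq' : H'.Path (f a) (f b) × H'.Path (f c) (f d), F' pq' :=
        ENNReal.tsum_comp_le_tsum_of_injective hginj F'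
    _ = _ := ENNReal.tsum_prod (f := fun γ γ' => F' (γ, γ'))

open Classical in
/-- **Disjoint-pair sums are invariant under graph isomorphisms.** [folklore] -/
theorem pairSum_map_iso (φ : H ≃g H') (x : ℝ) (a b c d : V) :
    (∑' (γ : H'.Path (φ a) (φ b)) (γ' : H'.Path (φ c) (φ d)),
        (if List.Disjoint γ.1.support γ'.1.support then
          ENNReal.ofReal (x ^ γ.1.length) * ENNReal.ofReal (x ^ γ'.1.length) else 0)) =
      ∑' (γ : H.Path a b) (γ' : H.Path c d),
        (if List.Disjoint γ.1.support γ'.1.support then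
          ENNReal.ofReal (x ^ γ.1.length) * ENNReal.ofReal (x ^ γ'.1.length) else 0) := by
  refine le_antisymm ?_ (pairSum_le_map φ.toHom φ.injective x a b c d)
  have h := pairSum_le_map φ.symm.toHom φ.symm.injective x (φ a) (φ b) (φ c) (φ d)
  have ha : φ.symm.toHom (φ a) = a := φ.symm_apply_apply a
  have hb : φ.symm.toHom (φ b) = b := φ.symm_apply_apply b
  have hc : φ.symm.toHom (φ c) = c := φ.symm_apply_apply c
  have hd : φ.symm.toHom (φ d) = d := φ.symm_apply_apply d
  rw [ha, hb, hc, hd] at h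
  exact h

end Generic

open Classical in
/-- **Reflection `j ↦ b - j` of the disjoint-pair sums of the box `{0..a} × {0..b}`.** [folklore] -/
theorem rect_pairSum_reflect_snd (a b : ℕ) (x : ℝ) (i₁ j₁ i₂ j₂ i₃ j₃ i₄ j₄ : ℤ) :
    (∑' (γ : (discreteDomainGraph (rectDomain a b) 1).Path (st i₁ j₁) (st i₂ j₂))
        (γ' : (discreteDomainGraph (rectDomain a b) 1).Path (st i₃ j₃) (st i₄ j₄)),
        (if List.Disjoint γ.1.support γ'.1.support then
          ENNReal.ofReal (x ^ γ.1.length) * ENNReal.ofReal (x ^ γ'.1.length) else 0)) =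
      ∑' (γ : (discreteDomainGraph (rectDomain a b) 1).Path (st i₁ (b - j₁)) (st i₂ (b - j₂)))
        (γ' : (discreteDomainGraph (rectDomain a b) 1).Path (st i₃ (b - j₃)) (st i₄ (b - j₄))),
        (if List.Disjoint γ.1.support γ'.1.support then
          ENNReal.ofReal (x ^ γ.1.length) * ENNReal.ofReal (x ^ γ'.1.length) else 0) := by
  obtain ⟨φ, hφ⟩ := exists_iso_rect_reflect_snd a b
  have h := pairSum_map_iso φ x (st i₁ j₁) (st i₂ j₂) (st i₃ j₃) (st i₄ j₄)
  rw [hφ, hφ, hφ, hφ] at h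
  simp only [st_zero, st_one] at h
  exact h.symm

open Classical in
/-- **Reflection `i ↦ a - i` of the disjoint-pair sums of the box `{0..a} × {0..b}`.** [folklore] -/
theorem rect_pairSum_reflect_fst (a b : ℕ) (x : ℝ) (i₁ j₁ i₂ j₂ i₃ j₃ i₄ j₄ : ℤ) :
    (∑' (γ : (discreteDomainGraph (rectDomain a b) 1).Path (st i₁ j₁) (st i₂ j₂))
        (γ' : (discreteDomainGraph (rectDomain a b) 1).Path (st i₃ j₃) (st i₄ j₄)),
        (if List.Disjoint γ.1.support γ'.1.support then
          ENNReal.ofReal (x ^ γ.1.length) * ENNReal.ofReal (x ^ γ'.1.length) else 0)) =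
      ∑' (γ : (discreteDomainGraph (rectDomain a b) 1).Path (st (a - i₁) j₁) (st (a - i₂) j₂))
        (γ' : (discreteDomainGraph (rectDomain a b) 1).Path (st (a - i₃) j₃) (st (a - i₄) j₄)),
        (if List.Disjoint γ.1.support γ'.1.support then
          ENNReal.ofReal (x ^ γ.1.length) * ENNReal.ofReal (x ^ γ'.1.length) else 0) := by
  obtain ⟨φ, hφ⟩ := exists_iso_rect_reflect_fst a b
  have h := pairSum_map_iso φ x (st i₁ j₁) (st i₂ j₂) (st i₃ j₃) (st i₄ j₄)
  rw [hφ, hφ, hφ, hφ] at h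
  simp only [st_zero, st_one] at h
  exact h.symm

/-! ## Finiteness on the 4-row strips -/

/-- The kernels of the 4-row strip are finite. [folklore] -/
theorem strip4_ne_top (L : ℕ) (x : ℝ) (a b : Site 2) :
    pathKernel (discreteDomainGraph (rectDomain L 3) 1) x a b ≠ ∞ :=
  pathKernel_ne_top (support_discreteDomainGraph_finite (isBounded_rectDomain L 3) one_pos) x a b

open Classical in
/-- The disjoint-pair sums of the 4-row strip are finite. [folklore] -/
theorem strip4_pair_ne_top (L : ℕ) (x : ℝ) (a b c d : Site 2) :
    (∑' (γ : (discreteDomainGraph (rectDomain L 3) 1).Path a b)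
        (γ' : (discreteDomainGraph (rectDomain L 3) 1).Path c d),
      (if List.Disjoint γ.1.support γ'.1.support then
        ENNReal.ofReal (x ^ γ.1.length) * ENNReal.ofReal (x ^ γ'.1.length) else 0)) ≠ ∞ :=
  ne_top_of_le_ne_top (ENNReal.mul_ne_top (strip4_ne_top L x a b) (strip4_ne_top L x c d))
    (strip3_pair_le _ x a b c d)

end Summit.CriticalPhenomena.SAWScalingLimit.Theorems.BoundaryTP2
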